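import Mathlib

/-!
# Eigenlines for distinct characters are linearly independent

Blind re-derivation cell `pub-hodge-repro`, seat `night-3` (gen 2).  Mathlib only.  Namespace `HodgeRepro.Night3.WeilModel`.

`Night3WeilModelBasis` shows that the lines of every corner product are linearly independent once the lines of every single
factor are (`hsingle`); `Night3WeilModelProduct` describes the single factor by its Rosati data: the lines `ℓ σ` of
`H^1(A_T) ⊗ ℂ` are eigenvectors of the CM field `F` for the pairwise distinct characters `χ σ = σ` (the embeddings).  This
file closes the gap with the classical argument (Dedekind's): **non-zero eigenvectors for pairwise distinct characters of a
ring action are linearly independent** — a minimal vanishing combination, acted on by `a ∈ F` and compared with its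
`χ j a`-multiple, yields a shorter vanishing combination with coefficients `g i (χ i a − χ j a)`; by induction these vanish,
and `χ i ≠ χ j` gives `g i = 0` (`linearIndependent_of_eigen`).  Nothing here closes S4; no sealed file is touched; no
Tier-2 item depends on this file.
-/

set_option autoImplicit false

namespace HodgeRepro.Night3.WeilModel

variable {L : Type*} [Field L] {V : Type*} [AddCommGroup V] [Module L V]
variable {F : Type*} [CommRing F] [Module F V] [SMulCommClass F L V]

/-- A vanishing combination of eigenvectors, acted on by `a` and compared with its `χ j a`-multiple, gives the vanishing
combination with coefficients `g i * (χ i a - χ j a)`. -/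
theorem sum_smul_sub_eq_zero {ι : Type*} (ℓ : ι → V) (χ : ι → (F →+* L))
    (hℓ : ∀ i (a : F), a • ℓ i = χ i a • ℓ i) (s : Finset ι) (g : ι → L)
    (hsum : ∑ i ∈ s, g i • ℓ i = 0) (j : ι) (a : F) :
    ∑ i ∈ s, (g i * (χ i a - χ j a)) • ℓ i = 0 := by
  have h1 : ∑ i ∈ s, (g i * χ i a) • ℓ i = 0 := by
    have := congrArg (fun v => a • v) hsum
    simp only [Finset.smul_sum, smul_zero] at this
    rw [← this]
    refine Finset.sum_congr rfl fun i _ => ?_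
    rw [smul_comm, hℓ i a, smul_smul]
  have h2 : ∑ i ∈ s, (g i * χ j a) • ℓ i = 0 := by
    have := congrArg (fun v => χ j a • v) hsum
    simp only [Finset.smul_sum, smul_zero] at this
    rw [← this]
    refine Finset.sum_congr rfl fun i _ => ?_
    rw [smul_smul, mul_comm]
  calc ∑ i ∈ s, (g i * (χ i a - χ j a)) • ℓ i
      = ∑ i ∈ s, (g i * χ i a) • ℓ i - ∑ i ∈ s, (g i * χ j a) • ℓ i := by
        rw [← Finset.sum_sub_distrib]
        exact Finset.sum_congr rfl fun i _ => by rw [← sub_smul, mul_sub]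
    _ = 0 := by rw [h1, h2, sub_zero]

/-- **Eigenvectors for pairwise distinct characters are linearly independent** (Dedekind): if `a • ℓ i = χ i a • ℓ i`
for all `a : F` with `χ` injective and every `ℓ i ≠ 0`, then the family `ℓ` is linearly independent over `L`. -/
theorem linearIndependent_of_eigen {ι : Type*} (ℓ : ι → V) (χ : ι → (F →+* L))
    (hℓ : ∀ i (a : F), a • ℓ i = χ i a • ℓ i) (hχ : Function.Injective χ) (hne : ∀ i, ℓ i ≠ 0) :
    LinearIndependent L ℓ := by
  classical
  rw [linearIndependent_iff']
  intro s
  induction s using Finset.strongInduction with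
  | H s ih =>
    intro g hsum j hj
    -- the coefficients at the other indices vanish
    have hother : ∀ i ∈ s, i ≠ j → g i = 0 := by
      intro i hi hij
      obtain ⟨a, ha⟩ : ∃ a : F, χ i a ≠ χ j a := by
        by_contra h
        exact hij (hχ (RingHom.ext fun a => not_not.mp fun h' => h ⟨a, h'⟩))
      have hsub := sum_smul_sub_eq_zero ℓ χ hℓ s g hsum j a
      have hsub' : ∑ i ∈ s.erase j, (g i * (χ i a - χ j a)) • ℓ i = 0 := by
        rw [← Finset.add_sum_erase s _ hj] at hsub
        simpa using hsub
      have := ih (s.erase j) (Finset.erase_ssubset hj) _ hsub' i (Finset.mem_erase.mpr ⟨hij, hi⟩)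
      exact (mul_eq_zero.mp this).resolve_right (sub_ne_zero.mpr ha)
    -- hence the combination is `g j • ℓ j = 0`
    have hj' : g j • ℓ j = 0 := by
      rw [← Finset.add_sum_erase s _ hj, Finset.sum_eq_zero] at hsum
      · simpa using hsum
      · intro i hi
        rw [hother i (Finset.mem_of_mem_erase hi) (Finset.ne_of_mem_erase hi), zero_smul]
    exact (smul_eq_zero.mp hj').resolve_right (hne j)

end HodgeRepro.Night3.WeilModel
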